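import Summits.RiemannHypothesis.RiemannHypothesis.Theorems.ScrewManifestCertDual
import Summits.RiemannHypothesis.RiemannHypothesis.Theorems.ScrewManifestCertTopBlock

/-!
# Prime-hinge coordinates for the screw matrices (RH-FREE structure; support file for `IntegerScrewPSD`)

Source: planner seat rh-explicit-screw-idea-1 gen2 (lens dual-witness), HOME/rh-explicit-screw-idea-1/g2/PrimeHinge.lean
(sha16 f067635bef719c9c, farm rc 0), idea card «prime-hinge-nyquist-duality» (evidence #1–#3 on stmt-RiemannHypothesis-19312);
landed verbatim (statements and proofs) by a prover seat as a `--supports stmt-RiemannHypothesis-15756` file at the request of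
the SCREW custody planner (sos-theory g18, 2026-08-26) and director-rh g5. Clerical deltas only: namespace `…Manifest.SketchG2` ↦
`…Manifest.PrimeHinge`, missing docstrings added, `push_neg` ↦ `push Not`, linter options as in the sibling Manifest files.

CONTENT. `Ψ = Ψ_arch − φ`, `φ(t) = Σ_{k ≤ n+1} Λ(k) k^{-1/2} (|t| − log k)_+` on all node values and lags (tree:
`zetaScrewPrimeSum_eq_sum_max`), hence the MATRIX identity
`S_{n+1} = K[Ψ_arch] − Σ_{k ≤ n+1} Λ(k) k^{-1/2} · K[h_{log k}]`, `h_v(x) = (|x| − v)_+`,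
with `K[g](i,j) = g(x_i) + g(x_j) − g(x_i − x_j)` the Kreĭn kernel matrix of `g` on the nodes `x_i = log(i+2)`
(`screwMatrix_eq_arch_sub_hinge`). For ANY dual matrix `Y`: `⟨S, Y⟩ = ⟨K[Ψ_arch], Y⟩ − Σ_k Λ(k) k^{-1/2} ⟨K[h_{log k}], Y⟩`
(`frob_screw_hinge`) — the primes enter the Nyquist dual LP through one positive point functional of `v ↦ ⟨K[h_v], Y⟩`
(the HINGE TRANSFORM of the dual) at the kinks `v = log k`. Typed conjecture SLOTS (nothing asserted): K1
`ArchPairingNonnegBeyond θ₀` / `PrimeHingeNecessity`, K2 `LapDualLinearithmic` and its intra-octave (prime-free) variants,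
`LinearithmicNyquistFloor`; PROVED glue: `hinge_pos_of_necessity`, `notManifest_of_lapDual`, `intraOctave_imp`, `not_both`,
`primeFunctional_eq_zero_of_intraOctave`, `intraOctave_cap_of_necessity`, `no_intraOctave_linearithmic_of_necessity`.

LABEL: RH-FREE (identities about Suzuki's integer screw matrices and the manifest/dual certificate dictionary; the K1/K2
slots are conjectures with named falsifiers, no constant asserted). WHAT THIS IS NOT: not a proof or disproof of RH; no bound
on `λ_min(S_M)`; nothing here bears on the truth of RH.
-/

-- `Summit.RiemannHypothesis.RiemannHypothesis.…` duplicates `RiemannHypothesis` BY DESIGN (D-0017).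
set_option linter.dupNamespace false
set_option autoImplicit false

namespace Summit.RiemannHypothesis.RiemannHypothesis.Theorems.IntegerScrew.Manifest.PrimeHinge

open Summit.RiemannHypothesis.RiemannHypothesis.Theorems.IntegerScrew.Manifest
open Literature.NumberTheory.LFunctions Matrix

/-- The prime-free part of `Ψ`: `Ψ_arch = Ψ + φ` (polar + linear + Hurwitz–Lerch terms). -/
noncomputable def zetaScrewArch (t : ℝ) : ℝ := zetaScrew t + zetaScrewPrimeSum t

/-- Kreĭn kernel matrix of a real function `g` on the nodes: `K[g](i,j) = g(x_i) + g(x_j) − g(x_i − x_j)`. -/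
noncomputable def kreinMat (n : ℕ) (g : ℝ → ℝ) : Matrix (Fin n) (Fin n) ℝ :=
  Matrix.of fun i j => g (node n i) + g (node n j) - g (node n i - node n j)

/-- The hinge profile `h_v(x) = (|x| − v)_+`. -/
noncomputable def hinge (v x : ℝ) : ℝ := max (|x| - v) 0

/-- The HINGE TRANSFORM of a (dual) matrix: `v ↦ ⟨K[h_v], Y⟩`. -/
noncomputable def hingeTransformY {n : ℕ} (Y : Matrix (Fin n) (Fin n) ℝ) (v : ℝ) : ℝ := frob (kreinMat n (hinge v)) Y

/-- The ARCHIMEDEAN PAIRING of a (dual) matrix: `⟨K[Ψ_arch], Y⟩`. -/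
noncomputable def archPairing {n : ℕ} (Y : Matrix (Fin n) (Fin n) ℝ) : ℝ := frob (kreinMat n zetaScrewArch) Y

/-- The nodes `x_i = log(i+2)` are non-negative. -/
theorem node_nonneg (n : ℕ) (i : Fin n) : 0 ≤ node n i :=
  Real.log_nonneg (by exact_mod_cast (by omega : 1 ≤ (i : ℕ) + 2))

/-- `e^{|x_i|} = i + 2 ≤ n + 1`. -/
theorem exp_node_le (n : ℕ) (i : Fin n) : Real.exp |node n i| ≤ ((n + 1 : ℕ) : ℝ) := by
  rw [abs_of_nonneg (node_nonneg n i), node, Real.exp_log (by exact_mod_cast (by omega : 0 < (i : ℕ) + 2))]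
  exact_mod_cast (by omega : (i : ℕ) + 2 ≤ n + 1)

/-- The lag of two nodes exponentiates below `n + 1`: `e^{|x_i − x_j|} ≤ n + 1`. -/
theorem exp_abs_lag_le (n : ℕ) (i j : Fin n) :
    Real.exp |node n i - node n j| ≤ ((n + 1 : ℕ) : ℝ) := by
  have hi := node_nonneg n i
  have hj := node_nonneg n j
  have hin : node n i ≤ Real.log ((n + 1 : ℕ) : ℝ) :=
    Real.log_le_log (by exact_mod_cast (by omega : 0 < (i : ℕ) + 2)) (by exact_mod_cast (by omega : (i : ℕ) + 2 ≤ n + 1))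
  have hjn : node n j ≤ Real.log ((n + 1 : ℕ) : ℝ) :=
    Real.log_le_log (by exact_mod_cast (by omega : 0 < (j : ℕ) + 2)) (by exact_mod_cast (by omega : (j : ℕ) + 2 ≤ n + 1))
  have habs : |node n i - node n j| ≤ Real.log ((n + 1 : ℕ) : ℝ) := by
    rw [abs_le]; constructor <;> linarith
  have hpos : (0 : ℝ) < ((n + 1 : ℕ) : ℝ) := by positivity
  calc Real.exp |node n i - node n j| ≤ Real.exp (Real.log ((n + 1 : ℕ) : ℝ)) := Real.exp_le_exp.mpr habs
    _ = ((n + 1 : ℕ) : ℝ) := Real.exp_log hpos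

/-- `Ψ(t) = Ψ_arch(t) − Σ_{k ≤ n+1} Λ(k) k^{-1/2} h_{log k}(t)` whenever `e^{|t|} ≤ n + 1`. -/
theorem zetaScrew_eq_arch_sub_hinge {n : ℕ} {t : ℝ} (ht : Real.exp |t| ≤ ((n + 1 : ℕ) : ℝ)) :
    zetaScrew t = zetaScrewArch t
      - ∑ k ∈ Finset.Icc 1 (n + 1), ArithmeticFunction.vonMangoldt k / Real.sqrt k * hinge (Real.log k) t := by
  simp only [zetaScrewArch, hinge]
  rw [← zetaScrewPrimeSum_eq_sum_max ht]
  ring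

/-- RH-FREE, PROVED: the screw matrix in prime-hinge coordinates,
`S_{n+1} = K[Ψ_arch] − Σ_{k ≤ n+1} Λ(k) k^{-1/2} · K[h_{log k}]`. -/
theorem screwMatrix_eq_arch_sub_hinge (n : ℕ) :
    screwMatrix n = kreinMat n zetaScrewArch
      - ∑ k ∈ Finset.Icc 1 (n + 1), (ArithmeticFunction.vonMangoldt k / Real.sqrt k) • kreinMat n (hinge (Real.log k)) := by
  ext i j
  have hS : screwMatrix n i j = zetaScrew (node n i) + zetaScrew (node n j) - zetaScrew (node n i - node n j) := by
    simp [screwMatrix, node, zetaScrewKernel_def]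
  rw [hS, zetaScrew_eq_arch_sub_hinge (exp_node_le n i), zetaScrew_eq_arch_sub_hinge (exp_node_le n j),
    zetaScrew_eq_arch_sub_hinge (exp_abs_lag_le n i j)]
  simp only [Matrix.sub_apply, kreinMat, Matrix.of_apply, Matrix.sum_apply, Matrix.smul_apply, smul_eq_mul,
    mul_add, mul_sub, Finset.sum_add_distrib, Finset.sum_sub_distrib]
  ring

/-- The Frobenius pairing is additive in its left argument over a `Finset` sum. -/
theorem frob_finset_sum_left {n : ℕ} {ι : Type*} (s : Finset ι) (A : ι → Matrix (Fin n) (Fin n) ℝ)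
    (Y : Matrix (Fin n) (Fin n) ℝ) : frob (∑ k ∈ s, A k) Y = ∑ k ∈ s, frob (A k) Y := by
  classical
  induction s using Finset.induction_on with
  | empty => simp [frob]
  | insert a s ha ih => rw [Finset.sum_insert ha, frob_add_left, ih, Finset.sum_insert ha]

/-- RH-FREE, PROVED: for ANY matrix `Y`, `⟨S_{n+1}, Y⟩ = ⟨K[Ψ_arch], Y⟩ − Σ_{k ≤ n+1} Λ(k) k^{-1/2} ⟨K[h_{log k}], Y⟩`. -/
theorem frob_screw_hinge (n : ℕ) (Y : Matrix (Fin n) (Fin n) ℝ) :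
    frob (screwMatrix n) Y = archPairing Y
      - ∑ k ∈ Finset.Icc 1 (n + 1), ArithmeticFunction.vonMangoldt k / Real.sqrt k * hingeTransformY Y (Real.log k) := by
  rw [screwMatrix_eq_arch_sub_hinge, frob_sub_left, frob_finset_sum_left]
  simp only [frob_smul_left, archPairing, hingeTransformY]

/-- CRUX K1 (RH-free, typed; «PRIME-HINGE NECESSITY beyond the cusp regime»): beyond height `θ₀·M` every dual certificate
against manifest certificates has NONNEGATIVE archimedean pairing — its negativity is carried by the von Mangoldt hinge
functional.  Census (certified, M = 32, 64, 96, 128 at T/M = 3.3…4.0): `2·archPairing = +0.392, +0.157, +0.153, +0.094 > 0`. -/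
def ArchPairingNonnegBeyond (θ₀ : ℝ) : Prop :=
  ∀ (n : ℕ) (T : ℝ) (Y : Matrix (Fin n) (Fin n) ℝ), θ₀ * (n + 1) ≤ T → DualCert n (1 / 10) T Y → 0 ≤ archPairing Y

/-- CRUX K1 with the threshold slope existentially quantified: `∃ θ₀, ArchPairingNonnegBeyond θ₀` (RH-free conjecture
slot; nothing asserted). -/
def PrimeHingeNecessity : Prop := ∃ θ₀ : ℝ, ArchPairingNonnegBeyond θ₀

/-- PROVED glue: K1 ⇒ every dual beyond `θ₀·M` has a POSITIVE von Mangoldt hinge functional. -/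
theorem hinge_pos_of_necessity {θ₀ : ℝ} (h : ArchPairingNonnegBeyond θ₀) {n : ℕ} {T : ℝ}
    {Y : Matrix (Fin n) (Fin n) ℝ} (hT : θ₀ * (n + 1) ≤ T) (hY : DualCert n (1 / 10) T Y) :
    0 < ∑ k ∈ Finset.Icc 1 (n + 1), ArithmeticFunction.vonMangoldt k / Real.sqrt k * hingeTransformY Y (Real.log k) := by
  have hneg : frob (screwMatrix n) Y < 0 := hY.2.2.2
  have harch := h n T Y hT hY
  rw [frob_screw_hinge] at hneg
  linarith


/-! ## K2 — the order of the Nyquist floor (RH-free candidates; the census law `T_DD(M) ≈ 0.50·M ln M + 1.52·M`) -/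


/-- RH-FREE obstruction law, LINEARITHMIC NYQUIST FLOOR BY LAPLACIAN DUALS: signed-edge Laplacian dual certificates
(`lapY`, which pair with `S_{n+1}` only through `Ψ` at the LAGS `log((p+2)/(q+2))`) exclude manifest certificates up to
height `c·M·log M`.  Strictly stronger than `NyquistFloor` (linear); by `dualCert_sound` it gives
`¬ ManifestCert n (1/10) (c (n+1) log (n+1))` for all large `n`. -/
def LapDualLinearithmic : Prop :=
  ∃ c : ℝ, 0 < c ∧ ∃ N0 : ℕ, ∀ n : ℕ, N0 ≤ n →
    ∃ (E : ℕ) (p q : Fin E → Fin n) (cc : Fin E → ℝ),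
      DualCert n (1 / 10) (c * (n + 1) * Real.log (n + 1)) (lapY n E p q cc)

/-- The PRIME-FREE sub-family: every edge has node ratio `< 2`, so every lag lies in `(0, log 2)` where `Ψ` has no
prime term (`Ψ = 8(cosh(u/2)−1) − (u/2)κ + ¼(ζ(2,¼) − e^{−u/2}Φ(e^{−2u},2,¼))`). -/
def IntraOctave {n E : ℕ} (p q : Fin E → Fin n) : Prop :=
  ∀ e, (q e : ℕ) + 2 < (p e : ℕ) + 2 ∧ (p e : ℕ) + 2 < 2 * ((q e : ℕ) + 2)

/-- RH-FREE, variant (i) «the log is archimedean»: intra-octave (prime-free) Laplacian duals already reach `c·M·log M`. -/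
def IntraOctaveLapDualLinearithmic : Prop :=
  ∃ c : ℝ, 0 < c ∧ ∃ N0 : ℕ, ∀ n : ℕ, N0 ≤ n →
    ∃ (E : ℕ) (p q : Fin E → Fin n) (cc : Fin E → ℝ), IntraOctave p q ∧
      DualCert n (1 / 10) (c * (n + 1) * Real.log (n + 1)) (lapY n E p q cc)

/-- RH-FREE, variant (ii)/(iii) «the log is arithmetic»: intra-octave (prime-free) Laplacian duals are LINEARLY CAPPED —
whatever they certify is `≤ C·M`; any linearithmic dual must see `Ψ` beyond `log 2` (prime kinks at lags `log q`) or the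
node heights `Ψ(log m)` (the diagonal law). -/
def IntraOctaveLapDualLinearCap : Prop :=
  ∃ C : ℝ, ∀ (n E : ℕ) (p q : Fin E → Fin n) (cc : Fin E → ℝ) (T : ℝ), IntraOctave p q →
    DualCert n (1 / 10) T (lapY n E p q cc) → T ≤ C * (n + 1)

/-- The linearithmic floor as a plain statement about manifest certificates (the format's sharp order, lower side;
companion of the RH-conditional `LinearithmicCeiling`). -/
def LinearithmicNyquistFloor : Prop :=
  ∃ c : ℝ, 0 < c ∧ ∃ N0 : ℕ, ∀ n : ℕ, N0 ≤ n → ∀ tmin T : ℝ, 0 < tmin → tmin ≤ 1 / 10 →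
    ManifestCert n tmin T → c * (n + 1) * Real.log (n + 1) ≤ T

/-- Soundness glue (PROVED here, two lines): Laplacian linearithmic duals ⇒ the linearithmic floor for the
dictionary `t_min = 1/10`. -/
theorem notManifest_of_lapDual (h : LapDualLinearithmic) :
    ∃ c : ℝ, 0 < c ∧ ∃ N0 : ℕ, ∀ n : ℕ, N0 ≤ n →
      ¬ ManifestCert n (1 / 10) (c * (n + 1) * Real.log (n + 1)) := by
  obtain ⟨c, hc, N0, h⟩ := h
  refine ⟨c, hc, N0, fun n hn => ?_⟩
  obtain ⟨E, p, q, cc, hY⟩ := h n hn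
  exact dualCert_sound hY

/-- Variant (i) implies K2: an intra-octave linearithmic Laplacian dual family is in particular a linearithmic Laplacian
dual family. -/
theorem intraOctave_imp (h : IntraOctaveLapDualLinearithmic) : LapDualLinearithmic := by
  obtain ⟨c, hc, N0, h⟩ := h
  exact ⟨c, hc, N0, fun n hn => by obtain ⟨E, p, q, cc, -, hY⟩ := h n hn; exact ⟨E, p, q, cc, hY⟩⟩

/-- The dichotomy the kit experiment j252040 probes numerically: (i) and the cap cannot both hold. -/
theorem not_both (h1 : IntraOctaveLapDualLinearithmic) (h2 : IntraOctaveLapDualLinearCap) : False := by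
  obtain ⟨c, hc, N0, h⟩ := h1
  obtain ⟨C, hC⟩ := h2
  -- pick n large with c (n+1) log(n+1) > C (n+1): n + 1 > exp (C / c)
  obtain ⟨n, hn⟩ := exists_nat_gt (max (N0 : ℝ) (Real.exp (C / c)))
  have hN0 : N0 ≤ n := by
    have := (le_max_left (N0 : ℝ) _).trans_lt hn
    exact_mod_cast this.le
  obtain ⟨E, p, q, cc, hio, hY⟩ := h n hN0
  have hT := hC n E p q cc _ hio hY
  have hexp : Real.exp (C / c) < (n : ℝ) + 1 := ((le_max_right _ _).trans_lt hn).trans (by linarith)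
  have hlog : C / c < Real.log ((n : ℝ) + 1) := by
    rw [← Real.log_exp (C / c)]
    exact Real.log_lt_log (Real.exp_pos _) hexp
  have hpos : (0 : ℝ) < (n : ℝ) + 1 := by positivity
  have : C < c * Real.log ((n : ℝ) + 1) := by
    have := (div_lt_iff₀ hc).mp hlog
    linarith [mul_comm (Real.log ((n:ℝ)+1)) c]
  have : C * ((n : ℝ) + 1) < c * ((n : ℝ) + 1) * Real.log ((n : ℝ) + 1) := by nlinarith
  linarith


/-! ## K1 ⇒ the linear cap for PRIME-FREE (intra-octave) Laplacian duals -/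

/-- The hinge profile is even in `x`. -/
theorem hinge_even (v : ℝ) : ∀ u, hinge v (-u) = hinge v u := fun u => by simp [hinge, abs_neg]

/-- The hinge transform of a Laplacian dual is twice the hinge transform of its lag measure (`v ≥ 0`). -/
theorem hingeTransformY_lapY {n E : ℕ} (p q : Fin E → Fin n) (c : Fin E → ℝ) {v : ℝ} (hv : 0 ≤ v) :
    hingeTransformY (lapY n E p q c) v = 2 * ∑ e, c e * hinge v (node n (p e) - node n (q e)) := by
  unfold hingeTransformY kreinMat
  rw [frob_krein_lapY (hinge v) (hinge_even v) (node n)]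
  have h0 : hinge v 0 = 0 := by simp [hinge, hv]
  simp [h0]

/-- An intra-octave edge has lag in `(0, log 2)`, hence its hinge at every kink `log k`, `k ≥ 2`, vanishes. -/
theorem hinge_log_eq_zero_of_intraOctave {n E : ℕ} {p q : Fin E → Fin n} (hio : IntraOctave p q) (e : Fin E)
    {k : ℕ} (hk : 2 ≤ k) : hinge (Real.log k) (node n (p e) - node n (q e)) = 0 := by
  obtain ⟨h1, h2⟩ := hio e
  have hqpos : (0 : ℝ) < (q e : ℕ) + 2 := by positivity
  have hppos : (0 : ℝ) < (p e : ℕ) + 2 := by positivity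
  have hlag : node n (p e) - node n (q e) = Real.log ((((p e : ℕ) : ℝ) + 2) / (((q e : ℕ) : ℝ) + 2)) := by
    rw [node, node, Real.log_div hppos.ne' hqpos.ne']
    push_cast; ring
  have hratio_lt : (((p e : ℕ) : ℝ) + 2) / (((q e : ℕ) : ℝ) + 2) < 2 := by
    rw [div_lt_iff₀ hqpos]; exact_mod_cast (by omega : (p e : ℕ) + 2 < 2 * ((q e : ℕ) + 2))
  have hratio_gt : 1 < (((p e : ℕ) : ℝ) + 2) / (((q e : ℕ) : ℝ) + 2) := by
    rw [lt_div_iff₀ hqpos, one_mul]; exact_mod_cast (by omega : (q e : ℕ) + 2 < (p e : ℕ) + 2)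
  have hlag_nonneg : 0 ≤ node n (p e) - node n (q e) := by rw [hlag]; exact Real.log_nonneg hratio_gt.le
  have hlag_lt : node n (p e) - node n (q e) < Real.log 2 := by
    rw [hlag]; exact Real.log_lt_log (by linarith) hratio_lt
  have hk2 : Real.log 2 ≤ Real.log k := Real.log_le_log (by norm_num) (by exact_mod_cast hk)
  simp only [hinge, abs_of_nonneg hlag_nonneg]
  exact max_eq_right (by linarith)

/-- For an intra-octave Laplacian dual the von Mangoldt hinge functional VANISHES (no prime is seen). -/
theorem primeFunctional_eq_zero_of_intraOctave {n E : ℕ} {p q : Fin E → Fin n} (hio : IntraOctave p q) (c : Fin E → ℝ) :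
    ∑ k ∈ Finset.Icc 1 (n + 1), ArithmeticFunction.vonMangoldt k / Real.sqrt k
      * hingeTransformY (lapY n E p q c) (Real.log k) = 0 := by
  refine Finset.sum_eq_zero fun k hk => ?_
  rcases Nat.lt_or_ge k 2 with hk2 | hk2
  · have : k = 1 := by have := (Finset.mem_Icc.mp hk).1; omega
    subst this; simp
  · rw [hingeTransformY_lapY p q c (Real.log_nonneg (by exact_mod_cast (by omega : 1 ≤ k)))]
    simp [hinge_log_eq_zero_of_intraOctave hio _ hk2]

/-- PROVED glue: K1 (prime-hinge necessity beyond `θ₀·M`) ⇒ the LINEAR CAP for prime-free Laplacian duals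
(`IntraOctaveLapDualLinearCap` with `C = θ₀`): an archimedean design cannot certify beyond `θ₀·M`. -/
theorem intraOctave_cap_of_necessity {θ₀ : ℝ} (h : ArchPairingNonnegBeyond θ₀) : IntraOctaveLapDualLinearCap := by
  refine ⟨θ₀, fun n E p q cc T hio hY => ?_⟩
  by_contra hT
  push Not at hT
  have hpos := hinge_pos_of_necessity h hT.le hY
  rw [primeFunctional_eq_zero_of_intraOctave hio cc] at hpos
  exact lt_irrefl _ hpos

/-- Hence, under K1, a linearithmic Nyquist floor by Laplacian duals needs PRIME-SEEING designs. -/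
theorem no_intraOctave_linearithmic_of_necessity (h : PrimeHingeNecessity) : ¬ IntraOctaveLapDualLinearithmic := by
  obtain ⟨θ₀, hθ⟩ := h
  exact fun h1 => not_both h1 (intraOctave_cap_of_necessity hθ)

end Summit.RiemannHypothesis.RiemannHypothesis.Theorems.IntegerScrew.Manifest.PrimeHinge
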